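import Summits.ValiantsHypothesis.ValiantsHypothesis.Theorems.FermionicJetQuadraticDcCdetHessianDiag

/-!
# Route `FermionicJet`, crux `QuadraticDcCdet` (stmt-ValiantsHypothesis-5343) — helper 6:
# the two smallest cases `n = 3, 4`

The uniform family (all-ones matrix with one off-diagonal entry `3 - n`, helpers 3–5) has a
nonsingular Hessian only from `n = 4` on, and the uniform kernel proof (helper 5b) needs `n ≥ 5`.
Here the two remaining instances are settled by explicit computation from the closed-form Hessian
entries (helpers 3, 3b): for `n = 3` the Hessian of `cdet₃` at `[[2,1,1],[1,1,1],[1,1,1]]`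
(a zero of `cdet₃ = 3x₁₁x₂₂x₃₃ - 2Σ x_{ii}x_{jk}x_{kj} + Σ_{3-cycles}`) is a `9 × 9` integer matrix with
inverse in `(1/20)ℤ`, and for `n = 4` the Hessian of `cdet₄` at the all-ones matrix with `(0,1)`
entry `-1` is a `16 × 16` integer matrix with inverse in `(1/315)ℤ`; in both cases
`Hess *ᵥ v = 0 ⟹ v = 0` is certified by explicit integer linear combinations (`linear_combination`).
HONEST FRAMING: finite instances of a dormant route's crux; nothing here bears on `VP ≠ VNP`, which
is NOT proved.
-/

noncomputable section

open Finset

-- layout Summits/ValiantsHypothesis/ValiantsHypothesis forces the duplicated namespace component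
set_option linter.dupNamespace false

namespace Summit.ValiantsHypothesis.ValiantsHypothesis.Theorems.FermionicJet.CdetHessian

set_option maxHeartbeats 4000000 in
/-- **`n = 3`**: the Hessian of `cdet₃` at the all-ones matrix with `(0,0)` entry `2` (a zero of
`cdet₃`) has trivial kernel. -/
theorem hessian_mulVec_eq_zero_imp_three {K : Type*} [Field K] [CharZero K] (v : Fin 3 × Fin 3 → K)
    (hv : (Literature.Computability.AlgebraicComplexity.hessianMatrix
      (Literature.Computability.AlgebraicComplexity.cdetPoly (Fin 3) K)
      (fun ij : Fin 3 × Fin 3 => if ij = ((0 : Fin 3), (0 : Fin 3)) then 1 + (((0 : ℕ) : K) + 1) else (1 : K))).mulVec v = 0) :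
    v = 0 := by
  have hι : Fintype.card (Fin 3) = 0 + 3 := by simp
  have h : ∀ c d : Fin 3, (Literature.Computability.AlgebraicComplexity.hessianMatrix
      (Literature.Computability.AlgebraicComplexity.cdetPoly (Fin 3) K)
      (fun ij : Fin 3 × Fin 3 => if ij = ((0 : Fin 3), (0 : Fin 3)) then 1 + (((0 : ℕ) : K) + 1) else (1 : K))).mulVec v (c, d) = 0 := fun c d => by rw [hv]; rfl
  have e00 : (3 : K) * v (1, 1) + (-2 : K) * v (1, 2) + (-2 : K) * v (2, 1) + (3 : K) * v (2, 2) = 0 := by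
    have h' := h 0 0
    simp only [Matrix.mulVec, dotProduct, Fintype.sum_prod_type, Fin.sum_univ_three, hessianMatrix_cdetPoly_diagPlus_apply hι (0 : Fin 3)] at h'
    norm_num [Fin.ext_iff] at h'
    linear_combination h'
  have e01 : (-2 : K) * v (1, 0) + (1 : K) * v (1, 2) + (1 : K) * v (2, 0) + (-2 : K) * v (2, 2) = 0 := by
    have h' := h 0 1
    simp only [Matrix.mulVec, dotProduct, Fintype.sum_prod_type, Fin.sum_univ_three, hessianMatrix_cdetPoly_diagPlus_apply hι (0 : Fin 3)] at h'
    norm_num [Fin.ext_iff] at h'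
    linear_combination h'
  have e02 : (1 : K) * v (1, 0) + (-2 : K) * v (1, 1) + (-2 : K) * v (2, 0) + (1 : K) * v (2, 1) = 0 := by
    have h' := h 0 2
    simp only [Matrix.mulVec, dotProduct, Fintype.sum_prod_type, Fin.sum_univ_three, hessianMatrix_cdetPoly_diagPlus_apply hι (0 : Fin 3)] at h'
    norm_num [Fin.ext_iff] at h'
    linear_combination h'
  have e10 : (-2 : K) * v (0, 1) + (1 : K) * v (0, 2) + (1 : K) * v (2, 1) + (-2 : K) * v (2, 2) = 0 := by
    have h' := h 1 0
    simp only [Matrix.mulVec, dotProduct, Fintype.sum_prod_type, Fin.sum_univ_three, hessianMatrix_cdetPoly_diagPlus_apply hι (0 : Fin 3)] at h'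
    norm_num [Fin.ext_iff] at h'
    linear_combination h'
  have e11 : (3 : K) * v (0, 0) + (-2 : K) * v (0, 2) + (-2 : K) * v (2, 0) + (6 : K) * v (2, 2) = 0 := by
    have h' := h 1 1
    simp only [Matrix.mulVec, dotProduct, Fintype.sum_prod_type, Fin.sum_univ_three, hessianMatrix_cdetPoly_diagPlus_apply hι (0 : Fin 3)] at h'
    norm_num [Fin.ext_iff] at h'
    linear_combination h'
  have e12 : (-2 : K) * v (0, 0) + (1 : K) * v (0, 1) + (1 : K) * v (2, 0) + (-4 : K) * v (2, 1) = 0 := by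
    have h' := h 1 2
    simp only [Matrix.mulVec, dotProduct, Fintype.sum_prod_type, Fin.sum_univ_three, hessianMatrix_cdetPoly_diagPlus_apply hι (0 : Fin 3)] at h'
    norm_num [Fin.ext_iff] at h'
    linear_combination h'
  have e20 : (1 : K) * v (0, 1) + (-2 : K) * v (0, 2) + (-2 : K) * v (1, 1) + (1 : K) * v (1, 2) = 0 := by
    have h' := h 2 0
    simp only [Matrix.mulVec, dotProduct, Fintype.sum_prod_type, Fin.sum_univ_three, hessianMatrix_cdetPoly_diagPlus_apply hι (0 : Fin 3)] at h'
    norm_num [Fin.ext_iff] at h'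
    linear_combination h'
  have e21 : (-2 : K) * v (0, 0) + (1 : K) * v (0, 2) + (1 : K) * v (1, 0) + (-4 : K) * v (1, 2) = 0 := by
    have h' := h 2 1
    simp only [Matrix.mulVec, dotProduct, Fintype.sum_prod_type, Fin.sum_univ_three, hessianMatrix_cdetPoly_diagPlus_apply hι (0 : Fin 3)] at h'
    norm_num [Fin.ext_iff] at h'
    linear_combination h'
  have e22 : (3 : K) * v (0, 0) + (-2 : K) * v (0, 1) + (-2 : K) * v (1, 0) + (6 : K) * v (1, 1) = 0 := by
    have h' := h 2 2
    simp only [Matrix.mulVec, dotProduct, Fintype.sum_prod_type, Fin.sum_univ_three, hessianMatrix_cdetPoly_diagPlus_apply hι (0 : Fin 3)] at h'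
    norm_num [Fin.ext_iff] at h'
    linear_combination h'
  have z00 : v (0, 0) = 0 := (mul_eq_zero.mp (show (20 : K) * v (0, 0) = 0 by
    linear_combination (-44 : K) * e00 + (-12 : K) * e01 + (-12 : K) * e02 + (-12 : K) * e10 + (14 : K) * e11 + (16 : K) * e12 + (-12 : K) * e20 + (16 : K) * e21 + (14 : K) * e22)).resolve_left (by norm_num)
  have z01 : v (0, 1) = 0 := (mul_eq_zero.mp (show (20 : K) * v (0, 1) = 0 by
    linear_combination (-12 : K) * e00 + (-2 : K) * e01 + (-16 : K) * e10 + (2 : K) * e12 + (-6 : K) * e20 + (4 : K) * e21 + (4 : K) * e22)).resolve_left (by norm_num)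
  have z02 : v (0, 2) = 0 := (mul_eq_zero.mp (show (20 : K) * v (0, 2) = 0 by
    linear_combination (-12 : K) * e00 + (-2 : K) * e02 + (-6 : K) * e10 + (4 : K) * e11 + (4 : K) * e12 + (-16 : K) * e20 + (2 : K) * e21)).resolve_left (by norm_num)
  have z10 : v (1, 0) = 0 := (mul_eq_zero.mp (show (20 : K) * v (1, 0) = 0 by
    linear_combination (-12 : K) * e00 + (-16 : K) * e01 + (-6 : K) * e02 + (-2 : K) * e10 + (4 : K) * e12 + (2 : K) * e21 + (4 : K) * e22)).resolve_left (by norm_num)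
  have z11 : v (1, 1) = 0 := (mul_eq_zero.mp (show (20 : K) * v (1, 1) = 0 by
    linear_combination (14 : K) * e00 + (4 : K) * e02 + (-7 : K) * e11 + (-6 : K) * e12 + (4 : K) * e20 + (-6 : K) * e21 + (-1 : K) * e22)).resolve_left (by norm_num)
  have z12 : v (1, 2) = 0 := (mul_eq_zero.mp (show (20 : K) * v (1, 2) = 0 by
    linear_combination (16 : K) * e00 + (2 : K) * e01 + (4 : K) * e02 + (4 : K) * e10 + (-6 : K) * e11 + (-6 : K) * e12 + (2 : K) * e20 + (-12 : K) * e21 + (-6 : K) * e22)).resolve_left (by norm_num)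
  have z20 : v (2, 0) = 0 := (mul_eq_zero.mp (show (20 : K) * v (2, 0) = 0 by
    linear_combination (-12 : K) * e00 + (-6 : K) * e01 + (-16 : K) * e02 + (4 : K) * e11 + (2 : K) * e12 + (-2 : K) * e20 + (4 : K) * e21)).resolve_left (by norm_num)
  have z21 : v (2, 1) = 0 := (mul_eq_zero.mp (show (20 : K) * v (2, 1) = 0 by
    linear_combination (16 : K) * e00 + (4 : K) * e01 + (2 : K) * e02 + (2 : K) * e10 + (-6 : K) * e11 + (-12 : K) * e12 + (4 : K) * e20 + (-6 : K) * e21 + (-6 : K) * e22)).resolve_left (by norm_num)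
  have z22 : v (2, 2) = 0 := (mul_eq_zero.mp (show (20 : K) * v (2, 2) = 0 by
    linear_combination (14 : K) * e00 + (4 : K) * e01 + (4 : K) * e10 + (-1 : K) * e11 + (-6 : K) * e12 + (-6 : K) * e21 + (-7 : K) * e22)).resolve_left (by norm_num)
  funext ⟨a, b⟩
  rw [Pi.zero_apply]
  fin_cases a <;> fin_cases b
  · exact z00
  · exact z01
  · exact z02
  · exact z10
  · exact z11
  · exact z12
  · exact z20
  · exact z21
  · exact z22

end Summit.ValiantsHypothesis.ValiantsHypothesis.Theorems.FermionicJet.CdetHessian
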